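import Literature.Barriers.AtomisticToContinuum.OneDimensionalHardCoreNarrow
import HarnessLib

/-!
# Barrier companion: bosonic hard rods on a ring (eighth audit of `OneDimensionalHardCore`, 2026-08-16)

`Literature/Barriers/AtomisticToContinuum/` (D-0021 barrier catalogue), sub-problem
`BoseEinsteinCondensation`. Companion of `OneDimensionalHardCore.lean` (statement + BARRIER block),
`OneDimensionalHardCoreProofs.lean` (`OneDimensionalHardCore_holds`) and
`OneDimensionalHardCoreNarrow.lean` (uniform mode bound, scale invariance).

**Why this file.** Every typed statement of the parent entry concerns the ZERO-RANGE hard core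
(Girardeau's state), which the conjunct's quadratic form does not see (parent caveat (e)); the
members of the conjunct's class `IsRepulsiveFiniteRange` transported to `d = 1` are the hard RODS
`v = ⊤·1_{[0,a]}`, `a > 0`, for which the parent entry had only a sketch (caveat (j): CUE Palm
measures) and an exact bordered-determinant formula (caveat (k)(5)). This file TYPES the hard-rod
objects faithfully — the explicit Nagamiya ground state on `[0, L)^N`, its one-body density matrix
and zero-momentum occupation, exactly as the parent types Girardeau's — and states the rod barrier
`OneDimensionalHardRods`: at every fixed density `ρ` with `ρa < 1/2`, `c₀(N)/N → 0` in the boxes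
`L = N/ρ`. It is PROVED in the tree: here for `a = 0` (`oneDimensionalHardRods_zero_range`, from the
parent) and for every `a ≥ 0`, `ρa < 1/2` downstream (`oneDimensionalHardRods_of_lt_half` in
`OneDimensionalHardCoreRodsFinal.lean`, whence `OneDimensionalHardRods_holds`; the chain of files
`…RodsAdjugate` to `…RodsFinal`), along the paper proof in the docstring of `OneDimensionalHardRods`
(an elementary argument along Parts A–H of the Proofs file, valid on paper for all `ρa ∉ E`,
`E = {1/2, 3/4, 5/6, …}`; the statement is the printed expectation for every `ρa < 1`).

**The objects.** For `N` rods of diameter `a ≥ 0` on the ring `ℝ/Lℤ ≅ [0, L)` with `Na < L`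
(free length `L' = L − Na`), the bosonic ground state of `H = −∑∂ᵢ² + ∑_{i<j} v(|xᵢ − xⱼ|)`,
`v = +∞·1_{[0,a)}`, is "the exact ground-state wavefunction
`Ψ₀(z₁,…,z_N) = (N!)^{-1/2}|det((L')^{-1/2}exp(ip'_k x_k))|` … `L' = L − aN` is the unexcluded
volume … and `x_k = z_k − (k−1)a` are the so-called rod coordinates corresponding to a given
ordering of the true particle coordinates `z₁ < z₂ − a < ⋯ < z_N − a(N−1)`"
[MazzantiEtAl2008, Eqs. (2)–(3)], i.e. Girardeau's state of the compressed ring evaluated at the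
rod coordinates [Nagamiya1940]. Here: `rodCompress a x j = x j − a·#{i : x i < x j}` (rod
coordinates anchored at the chart origin — symmetric in the labels), `rodAdmissible` (cyclic pair
distances `≥ a`), `rodState N L a = (L'/L)^{1/2}·1_Adm·girardeauState N L' ∘ rodCompress a`
(normalised on `[0, L]^N`: sector-wise the compression is a translation and the anchored chart
covers the ring configurations with Jacobian `L/L'`), and `rodDensityMatrix`,
`rodZeroMomentumOccupation` copied verbatim from the parent with `rodState` for `girardeauState`.

**What is NOT here.** The range `1/2 ≤ ρa < 1` (paper proof off `E` below; not typed); the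
`λ_max = c₀` Fourier step (as in the
parent: `ρ ≥ 0` pointwise and translation invariant, so `0 ≤ c_n ≤ c₀`); Dirichlet walls; soft
cores / finite Lieb–Liniger coupling (no free-fermion map; parent caveat (g)(2)).

## References

* [Nagamiya1940] T. Nagamiya, Proc. Phys.-Math. Soc. Japan 22 (1940) 705–720 (rod coordinates).
* [MazzantiEtAl2008] F. Mazzanti, G. E. Astrakharchik, J. Boronat, J. Casulleras, Phys. Rev. Lett.
  100 (2008) 020401, arXiv:0705.4377: Eqs. (2)–(4) (model, ground state, `E/N = π²ρ²/(6(1−ρa)²)`),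
  Eq. (11) and p. 4 (`K = (1 − ρa)²`, momentum distribution by quantum Monte Carlo).
* [ForresterEtAl2003] P. J. Forrester et al., Phys. Rev. A 67 (2003) 043607: §2.1.1–2.1.2 (the
  `a = 0` objects).
* [AgerskovReuversSolovej2025] J. Agerskov, R. Reuvers, J. P. Solovej, Commun. Math. Phys. 406
  (2025): §1.5 (momentum distribution of dilute 1D gases listed as open).
* [Widom1963] B. Widom, J. Chem. Phys. 39 (1963) 2808–2812 (insertion probability; ninth audit,
  evasion (x): the Neumann-contact rods of `OneDimensionalHardCoreNeumannRods.lean`).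
-/

noncomputable section

open MeasureTheory Filter Topology Finset
open scoped BigOperators

namespace Literature.Barriers.AtomisticToContinuum.BoseGas

/-! ### Rod coordinates and the Nagamiya ground state -/

/-- The **rank** of particle `j` in the configuration `x`: the number of particles strictly to its
left in the chart `[0, L)`. [cite: MazzantiEtAl2008, text after Eq. (3)] -/
def rodRank {N : ℕ} (x : Fin N → ℝ) (j : Fin N) : ℕ :=
  (Finset.univ.filter fun i : Fin N => x i < x j).card

/-- **Rod coordinates** (Nagamiya): `x_k ↦ x_k − (k−1)a` for the `k`-th particle from the left,
i.e. `x j − a · rodRank x j` — the excluded-volume compression anchored at the chart origin; it is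
symmetric in the labels. [cite: MazzantiEtAl2008, text after Eq. (3)] -/
def rodCompress {N : ℕ} (a : ℝ) (x : Fin N → ℝ) : Fin N → ℝ :=
  fun j => x j - a * rodRank x j

/-- Cyclic distance of two points of the chart `[0, L)` of the ring `ℝ/Lℤ`. [folklore] -/
def ringDist (L u v : ℝ) : ℝ := min |u - v| (L - |u - v|)

/-- **Hard-rod (admissible) configurations**: all cyclic pair distances are at least the rod
diameter `a` (the region where `∑_{i<j} v(|xᵢ−xⱼ|) < ∞` for `v = ⊤·1_{[0,a)}`).
[cite: MazzantiEtAl2008, Eq. (2)] -/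
def rodAdmissible {N : ℕ} (L a : ℝ) (x : Fin N → ℝ) : Prop :=
  ∀ i j : Fin N, i ≠ j → a ≤ ringDist L (x i) (x j)

/-- **The bosonic ground state of `N` hard rods of diameter `a` on a ring of circumference `L`**
(Nagamiya 1940): Girardeau's impenetrable-point state of the compressed ring `L' = L − Na`
evaluated at the rod coordinates, extended by zero off the admissible region, with the
normalisation factor `(L'/L)^{1/2}` that makes it a unit vector of `L²([0, L]^N)`
("the exact ground-state wavefunction" `(N!)^{-1/2}|det((L')^{-1/2}e^{ip'_k x_k})|`, `L' = L − aN`,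
`x_k = z_k − (k−1)a`). For `a = 0` it is `girardeauState` (`rodState_zero_range`).
[cite: MazzantiEtAl2008, Eqs. (2)–(3)] -/
def rodState (N : ℕ) (L a : ℝ) (x : Fin N → ℝ) : ℝ :=
  Real.sqrt ((L - N * a) / L) *
    Set.indicator {y : Fin N → ℝ | rodAdmissible L a y}
      (fun y => girardeauState N (L - N * a) (rodCompress a y)) x

/-- The **one-body density matrix** of the hard-rod ground state,
`ρ_N(x, y) = N ∫_{[0,L]^{N-1}} Ψ(X, x) Ψ(X, y) dX` (`0` for `N = 0`) — the parent's
`girardeauDensityMatrix` with `rodState` for `girardeauState`.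
[cite: MazzantiEtAl2008, p. 3 (one-body density matrix `n₁(z)`)] -/
def rodDensityMatrix : (N : ℕ) → ℝ → ℝ → ℝ → ℝ → ℝ
  | 0, _, _, _, _ => 0
  | n + 1, L, a, x, y => (n + 1 : ℝ) *
      ∫ X in Set.pi Set.univ (fun _ : Fin n => Set.Icc (0 : ℝ) L),
        rodState (n + 1) L a (Fin.snoc X x) * rodState (n + 1) L a (Fin.snoc X y)

/-- The **zero-momentum occupation** of the hard-rod ground state,
`c₀(N) = L⁻¹ ∫₀ᴸ∫₀ᴸ ρ_N(x, y) dx dy = ⟨φ₀, γ_N φ₀⟩` for the constant mode — the parent's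
`zeroMomentumOccupation` with `rodDensityMatrix`.
[cite: MazzantiEtAl2008, p. 4 (momentum distribution `n(k)`)] -/
def rodZeroMomentumOccupation (N : ℕ) (L a : ℝ) : ℝ :=
  L⁻¹ * ∫ x in Set.Icc (0 : ℝ) L, ∫ y in Set.Icc (0 : ℝ) L, rodDensityMatrix N L a x y

/-! ### Basic API -/

/-- The hard-rod ground state is non-negative. [cite: MazzantiEtAl2008, Eq. (3)] -/
theorem rodState_nonneg (N : ℕ) (L a : ℝ) (x : Fin N → ℝ) : 0 ≤ rodState N L a x := by
  unfold rodState
  refine mul_nonneg (Real.sqrt_nonneg _) ?_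
  by_cases hx : x ∈ {y : Fin N → ℝ | rodAdmissible L a y}
  · rw [Set.indicator_of_mem hx]; exact girardeauState_nonneg _ _ _
  · rw [Set.indicator_of_notMem hx]

/-- The hard-rod ground state vanishes off the admissible region (hard core).
[cite: MazzantiEtAl2008, Eq. (2)] -/
theorem rodState_eq_zero_of_not_admissible {N : ℕ} (L a : ℝ) {x : Fin N → ℝ}
    (hx : ¬ rodAdmissible L a x) : rodState N L a x = 0 := by
  unfold rodState
  rw [Set.indicator_of_notMem (by simpa using hx), mul_zero]

/-- The one-body density matrix of the (non-negative) hard-rod state has non-negative kernel.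
[cite: MazzantiEtAl2008, p. 3 (one-body density matrix `n₁(z)`)] -/
theorem rodDensityMatrix_nonneg (N : ℕ) (L a x y : ℝ) : 0 ≤ rodDensityMatrix N L a x y := by
  cases N with
  | zero => simp [rodDensityMatrix]
  | succ n =>
      show (0 : ℝ) ≤ (n + 1 : ℝ) * ∫ X in Set.pi Set.univ (fun _ : Fin n => Set.Icc (0 : ℝ) L),
        rodState (n + 1) L a (Fin.snoc X x) * rodState (n + 1) L a (Fin.snoc X y)
      refine mul_nonneg (by positivity) (integral_nonneg fun X => ?_)
      exact mul_nonneg (rodState_nonneg _ _ _ _) (rodState_nonneg _ _ _ _)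

/-- No particles, no condensate: `c₀(0) = 0`. [folklore] -/
@[simp] theorem rodZeroMomentumOccupation_zero (L a : ℝ) : rodZeroMomentumOccupation 0 L a = 0 := by
  simp [rodZeroMomentumOccupation, rodDensityMatrix]

/-! ### Zero range: the rod objects are the Girardeau objects -/

/-- With zero diameter every configuration of the box is admissible. [folklore] -/
theorem rodAdmissible_zero {N : ℕ} {L : ℝ} {x : Fin N → ℝ} (hx : ∀ i, x i ∈ Set.Icc 0 L) :
    rodAdmissible L 0 x := by
  intro i j _
  unfold ringDist
  refine le_min (abs_nonneg _) (sub_nonneg.mpr ?_)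
  have hi := hx i
  have hj := hx j
  rw [abs_sub_le_iff]
  constructor <;> linarith [hi.1, hi.2, hj.1, hj.2]

/-- At `a = 0` the rod coordinates are the particle coordinates. [folklore] -/
@[simp] theorem rodCompress_zero {N : ℕ} (x : Fin N → ℝ) : rodCompress 0 x = x := by
  funext j
  simp [rodCompress]

/-- **Zero range is Girardeau**: on the box `[0, L]^N`, `rodState N L 0 = girardeauState N L`.
[cite: ForresterEtAl2003, §2.1.1] -/
theorem rodState_zero_range {N : ℕ} {L : ℝ} (hL : 0 < L) {x : Fin N → ℝ}
    (hx : ∀ i, x i ∈ Set.Icc 0 L) : rodState N L 0 x = girardeauState N L x := by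
  unfold rodState
  rw [Set.indicator_of_mem (show x ∈ {y : Fin N → ℝ | rodAdmissible L 0 y} from
    rodAdmissible_zero hx)]
  simp [div_self hL.ne']

/-- Membership in the box is inherited by `Fin.snoc X x`. [folklore] -/
theorem snoc_mem_Icc {n : ℕ} {L : ℝ} {X : Fin n → ℝ}
    (hX : X ∈ Set.pi Set.univ (fun _ : Fin n => Set.Icc (0 : ℝ) L)) {x : ℝ} (hx : x ∈ Set.Icc 0 L) :
    ∀ i, (Fin.snoc X x : Fin (n + 1) → ℝ) i ∈ Set.Icc 0 L := by
  intro i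
  refine Fin.lastCases ?_ (fun j => ?_) i
  · simpa [Fin.snoc_last] using hx
  · simpa [Fin.snoc_castSucc] using hX j (Set.mem_univ _)

/-- **Zero range is Girardeau** for the density matrix on the box. [cite: ForresterEtAl2003, §2.1.2] -/
theorem rodDensityMatrix_zero_range (N : ℕ) {L : ℝ} (hL : 0 < L) {x y : ℝ}
    (hx : x ∈ Set.Icc 0 L) (hy : y ∈ Set.Icc 0 L) :
    rodDensityMatrix N L 0 x y = girardeauDensityMatrix N L x y := by
  cases N with
  | zero => simp [rodDensityMatrix, girardeauDensityMatrix]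
  | succ n =>
      show (n + 1 : ℝ) * ∫ X in Set.pi Set.univ (fun _ : Fin n => Set.Icc (0 : ℝ) L),
          rodState (n + 1) L 0 (Fin.snoc X x) * rodState (n + 1) L 0 (Fin.snoc X y) =
        (n + 1 : ℝ) * ∫ X in Set.pi Set.univ (fun _ : Fin n => Set.Icc (0 : ℝ) L),
          girardeauState (n + 1) L (Fin.snoc X x) * girardeauState (n + 1) L (Fin.snoc X y)
      congr 1
      refine setIntegral_congr_fun (MeasurableSet.univ_pi fun _ => measurableSet_Icc) fun X hX => ?_
      rw [rodState_zero_range hL (snoc_mem_Icc hX hx), rodState_zero_range hL (snoc_mem_Icc hX hy)]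

/-- **Zero range is Girardeau** for the zero-momentum occupation: `c₀^{rod}(N, L, 0) = c₀(N, L)`.
[cite: ForresterEtAl2003, §2.2.1] -/
theorem rodZeroMomentumOccupation_zero_range (N : ℕ) {L : ℝ} (hL : 0 < L) :
    rodZeroMomentumOccupation N L 0 = zeroMomentumOccupation N L := by
  unfold rodZeroMomentumOccupation zeroMomentumOccupation
  congr 1
  refine setIntegral_congr_fun measurableSet_Icc fun x hx => ?_
  exact setIntegral_congr_fun measurableSet_Icc fun y hy => rodDensityMatrix_zero_range N hL hx hy

end Literature.Barriers.AtomisticToContinuum.BoseGas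

namespace Literature.Barriers.AtomisticToContinuum

open BoseGas

/-- **No linear Bose–Einstein condensation for bosonic hard rods on a ring, at every fixed
density below the first commensurate packing fraction (eighth audit of `OneDimensionalHardCore`,
2026-08-16; a THEOREM of the tree, `OneDimensionalHardRods_holds` in
`OneDimensionalHardCoreRodsFinal.lean`).** For every rod diameter `a ≥ 0` and every density `ρ > 0`
with `ρa < 1/2`, the zero-momentum occupation of the Nagamiya ground state of `N` hard rods in the
ring of circumference `L = N/ρ` is `o(N)`: `c₀(N)/N → 0` (expected, and proved on paper below off a
countable set, for every `ρa < 1`; typed is the proved range). This is the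
literal one-dimensional transport, at packing fraction `η = ρa ∈ [0, 1/2)`, of the NEGATION of the
conjunct's `HasGroundStateBEC v ρ` for the class member `v = ⊤·1_{[0,a]}` (constant mode; the
plane waves diagonalise `γ_N` and `0 ≤ c_n ≤ c₀ = λ_max` because `ρ_N ≥ 0` pointwise,
`rodDensityMatrix_nonneg`, an untyped Fourier step as in the parent). Printed status: the rod gas is
a Luttinger liquid with `K = (1 − ρa)²`, `S(k → 0) ≈ (1 − an)²|k|/(2πn)`, one-body density matrix
`∝ |x|^{-1/(2K)}`, hence `c₀ ≍ N^{1 − 1/(2K)} = N^{1/2 − ρa + O((ρa)²)}` for `ρa < 1 − 1/√2` and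
`O(1)` beyond — quantum Monte Carlo plus bosonisation, not a theorem
[cite: MazzantiEtAl2008, Eqs. (4)–(5), Eq. (11) and p. 4]; the momentum distribution of dilute
one-dimensional gases is listed as open [cite: AgerskovReuversSolovej2025, §1.5]. PROOF ON PAPER
(this audit; elementary; all `N`; every packing fraction `η ∈ [0,1)` with `cos(πη/(2(1−η))) ≠ 0`,
i.e. all `η < 1/2` and all `η` off the countable commensurate set `E = {(2j−1)/(2j) : j ≥ 1}`, see
step (5); `c₀(N) ≤ C(η) N/√(log N)`; corrected 2026-08-16, same audit, superseding the first
accepted text which carried uncentred phases in steps (3), (5)): (1) tag the rod at `0`; in rod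
coordinates `w_j = x_j − (j−1)a` of the cyclically ordered spectators the admissible region is the
cube `[0, L']^{N−1}` sector by sector (translations, Jacobian 1), and moving the tagged rod to `x'`
across `m` spectators gives `Ψ(X, x') = (L'/L)^{1/2} Ψ_TG(t; w_j + a (crossed), w_j (uncrossed))`,
`t = x' − ma`, with NO spectator in the window `(t − a, t)`; hence
`c₀ = ∫₀^{L−(N−1)a} E(t) dt`, `E(t) = N(L'/L)∫_{([0,t−a]∪[t,L'])^{N−1}} Ψ_TG(0,w)Ψ_TG(t,T_t w) dw`
(`T_t` shifts the coordinates `≤ t − a` by `+a`); (2) Girardeau's sign trick with shifts: with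
`e(y) = e^{2πiy/L'}` and the Vandermondes `Δ(E)`, `Δ(E')` of `E = (e(0), e(w_j))`,
`E' = (e(t), e(T_t w_j))` (same labels), `|Δ(E)||Δ(E')| = (−1)^m e^{iπ(N−1)x'/L'} Δ(E) conj Δ(E')`
(exactly the `m` pairs (tagged, crossed) flip; the empty window preserves all other orders; the
phase is `e^{i(N−1)(∑θ'−∑θ)/2}`, `∑θ' − ∑θ = 2π(t + ma)/L'`); hence, with the unimodular one-body
weight `σ = −e^{iπ(N−1)a/L'}` on `[0, t−a]` and `σ = 1` on `[t, L']` (absorbing `(−1)^m` AND the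
`m`-dependent part of the phase), `∏_jσ(w_j) Δ(E) conj Δ(E') = e^{−iπ(N−1)t/L'}|Δ(E)||Δ(E')|`;
(3) Andréief + Laplace along the tagged row (Parts B–E of the Proofs file with `σ` for `sgnFun`
and `e(T_t ·)` in the conjugated determinant): `E(t) = L⁻¹ × phase × ⟨u(t), adj A(t) u(0)⟩`,
`‖u‖² = N`, with `A(t)_{kl} = ⟨φ_k, g_l φ_l⟩`, `φ_l = e^{2πil·/L'}/√L'`,
`g_l = 1_{[t,L']} − c_l 1_{[0,t−a]}`, `c_l = e^{−ik_l a}`, `k_l = 2π(l − (N−1)/2)/L'` — the CENTRED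
momenta of the parent's caveat (k)(5) (`σ·conj(e(w+a))^l = −c_l conj(e(w))^l`); at `a = 0`,
`A = 1 − 2Q` (Lenard); (4) `A(t)` is the compression of the contraction
`f ↦ σ·(f∘T_t)·1_{no window}` (`‖Rf‖² = ∫_a^{L'}|f|²`), so `‖A v‖ ≤ ‖v‖` (Bessel), and for such `A`
`|⟨x, adj(A) y⟩| ≤ e^{1/4}exp(−(N − ‖A‖²_HS)/4)‖x‖‖y‖` (Part F of the Proofs file applied to
`AAᴴ`, `adj(A)ᴴadj(A) = adj(AAᴴ)`, `tr(AAᴴ)² ≤ ‖A‖²_HS`; typed: `OneDimensionalHardCoreRodsAdjugate`)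
— on paper even `‖adj A‖ ≤ e^{1/2}exp(−(N − ‖A‖²_HS)/2)` by singular values; (5) deficiency:
writing `g_l = 1 − 1_{[t−a,t)} − (1 + c_l)1_{[0,t−a)}`, pure algebra and Bessel for the two-step
function `1_{[t−a,t)} + (1+c_l)1_{[0,t−a)}` give, for every finite frequency set `S ⊇ W − l`
(`W = {0,…,N−1}`), `1 − ∑_{k∈W} |A_{kl}|² ≥ ½|1 + c_l|² ∑_{j ∈ S∖(W−l)} |q_{[0,t−a)}(j)|²`,
`|1 + c_l|² = 4cos²(k_l a/2)`; at the band edge `k_0 a/2 = −π(N−1)a/(2L') → −θ_η`,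
`θ_η := πη/(2(1−η))`, and consecutive `l` advance the angle by `πa/L' = πη/((1−η)N)`, so IF
`cos θ_η ≠ 0` then for `ε = ε(η)` small and `N` large `cos²(k_l a/2) ≥ ½cos²θ_η` for all
`l < N₁ := ⌊εN⌋` (`N₁ = N` when `a = 0`), and the Proofs file's `tail_block_lower_bound` on the
blocks `{−(l+1),…,−(3l+2)}` yields `N − ‖A(t)‖²_HS ≥ cos²θ_η · sin²(π(t−a)/L') H_{N₁}/(18π²)` on
`t ∈ [a, L']` (`H_n` the harmonic number); if instead `η ∈ E` (`a = (2j−1)L'/N`: the rod length is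
an odd multiple of the mean free spacing and the phases `c_l` run through `N`-th roots of `−1`
across the band) the same exact formula shows that the Hilbert–Schmidt deficiency of `A(t)` stays
BOUNDED in `N`, the Gaussian adjugate bound yields no decay, and the statement at these packing
fractions needs another argument (e.g. the sum-rule route of the parent's caveat (j)) — left OPEN
here (numerics of the audit: compute job `deficiency_check.py`); (6) assembly as Part H for
`η ∉ E`: `c₀/N ≤ 2e^{1/4}η/N + e^{1/4}(1−η)∫₀¹exp(−cos²θ_η sin²(πu)H_{N₁}/(72π²))du → 0`.
At `a = 0` this is the tree's proof of the parent; the `a = 0` instance of the statement is proved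
below from the parent (`oneDimensionalHardRods_zero_range`).
BARRIER (D-0021), AtomisticToContinuum/BoseEinsteinCondensation:
technique_class: dimension-independent coupling-independent excluded-volume hard-core finite-range ground-state repulsive-generic
blocks: everything the parent `OneDimensionalHardCore`/`OneDimensionalHardCoreNarrow` block, WITHOUT the escape of parent caveat (e)/(g)(1): a mechanism for `BoseEinsteinCondensation` that stays valid verbatim for bosonic hard rods `v = ⊤·1_{[0,a]}` in `d = 1` at some fixed density `ρ < 1/(2a)` (typed and proved; on paper every `ρ < 1/a` off the commensurate set `E`) — in particular one that USES the positive range / excluded volume `ρa^d > 0` or the finite-range structure of `v` essentially, or whose constants `c(ρ)` and onsets `N₀(ρ)` degenerate as `ρ → 0` — because for rods `HasGroundStateBEC` fails at EACH fixed `ρ` separately (no uniformity in `ρ` is needed)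
because: excluded-volume map to the impenetrable point gas on the compressed ring [cite: Nagamiya1940] [cite: MazzantiEtAl2008, Eqs. (2)–(3)]; then Lenard's cofactor formula with the crossed fermions translated by `a` and a window of length `a` deleted, the Gaussian bound on the adjugate, and the logarithmic growth of the phase-weighted free-fermion number variance (this entry's proof, steps (1)–(6)); physically `K = (1−ρa)² < 1`, `S(k) ≈ K|k|/(2πρ)` [cite: MazzantiEtAl2008, Eq. (5) and Eq. (11)]
evasions_known: as the parent, (i)–(x) — in particular (x) CONTACT LAW (ninth audit 2026-08-16): the NEUMANN-contact realisation of the very same rods (zero-energy ground state `Z_N^{-1/2}1_{A_N}` on the same admissible set) CONDENSES, `c₀(N)/N ≥ 1 − 2ρa` for every `N ≥ 1` along `L = N/ρ`, `ρa < 1/2` (companion `OneDimensionalHardCoreNeumannRods.lean`, contrast theorem `neumann_vs_dirichlet_rods` with `OneDimensionalHardRods_holds`; exact limit `(1−ρa)e^{−ρa/(1−ρa)}` [cite: Widom1963, insertion probability]), so what this entry's witness uses is the Dirichlet contact law, not the excluded volume — except that for rods "weak coupling" (ii) is not available inside the family (the rod gas has no coupling constant; its only parameter is `η = ρa`, and `η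 → 0` is the Tonks–Girardeau gas): a mechanism evades only by using `d ≥ 2`/`d = 3` essentially, or hypotheses that fail for rods but hold for the conjunct's soft potentials at small `ρa³` (weak coupling in the sense of a scattering solution close to `1`, Bogoliubov theory) — soft cores and finite Lieb–Liniger coupling in `d = 1` are NOT covered by anything typed or proved here (expected `c₀ ≍ N^{1−1/(2K)}`, `K > 1`, still `o(N)` but closer to linear; parent caveat (g)(2), [cite: AgerskovReuversSolovej2025, §1.5])
scope_caveats: (a) typed: the explicit Nagamiya state on a PERIODIC ring, its density matrix and `c₀`; that this state is the bosonic ground state of the hard-rod Hamiltonian is cited [cite: MazzantiEtAl2008, Eq. (3)] [cite: Nagamiya1940], exactly as `girardeauState` is [cite: Girardeau1960] in the parent; (b) the STATEMENT is typed on the proved range `ρa < 1/2` (amended 2026-08-16 from `ρa < 1` once the typed proof landed; D-0026: a theorem, not a fact) and PROVED IN THE TREE: `OneDimensionalHardRods_holds` / `oneDimensionalHardRods_of_lt_half` in `OneDimensionalHardCoreRodsFinal.lean` (downstream of this file, hence not restated here; chain `…RodsAdjugate`, `…RodsLenard`, `…RodsBessel`, `…RodsContraction`, `…RodsDeficiency`,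 `…RodsSign`, `…RodsDensity`, `…RodsMajorant`, `…RodsRotate`, `…RodsShift`, `…RodsCompress`, `…RodsCoV`, `…RodsFinal`: Lenard's rod formula, the adjugate bound, the Hilbert–Schmidt deficiency of the rod matrix, the excluded-volume change of variables with `Mathlib`'s `lintegral_image_eq_lintegral_abs_det_fderiv_mul`; axioms `propext`/`Classical.choice`/`Quot.sound` only), and at `a = 0` directly from the parent (`oneDimensionalHardRods_zero_range`); the range `1/2 ≤ ρa < 1` is NOT typed: proved on paper above for `ρa ∉ E`, OPEN by the present method at the commensurate packing fractions `E = {1/2, 3/4, 5/6, …}`, and the printed expectation throughout [cite: MazzantiEtAl2008, p. 4] (the typed majorant uses the phase angle `θ = πρa/(2(1−ρa))`, which reaches `π/2` at `ρa = 1/2`; the `εN`-window argument of step (5) for `1/2 < ρa < 1`, `ρa ∉ E`, is not typed) — irrelevant for the barrier's use, which transports the conjunct's DILUTE regime; (c) `λ_max = c₀`: TYPED at the ninth audit (2026-08-16) in the companion `OneDimensionalHardCoreRodsModes.lean` (downstream of the proof chain, hence not restated here) — `|⟨φ, γ^{rod}_N φ⟩| ≤ c₀^{rod}(N)‖φ‖²`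 for every `N`, `L`, `a` and every mode with `|φ|²` integrable on `[0, L]` (Schur test with the a.e. row/column identities of the translation-invariant kernel, `norm_rodForm_le_rodZeroMomentumOccupation`), with equality at the constant mode (`rodForm_const_one`), hence along `L = N/ρ`, `ρa < 1/2`, the uniform mode bound `|⟨φ, γ^{rod}_N φ⟩| ≤ εN‖φ‖²` for all large `N` (`eventually_norm_rodForm_le`), the negated `HasGroundStateBEC` shape uniformly over modes (`not_exists_linear_le_rodForm`) and the negation of the conjunct's dilute quantifier shape `∃ ρ₀ > 0, ∀ ρ < ρ₀, ∃ c > 0, ∀ᶠ N, ∃ φ, …` for rods of every length (`not_exists_dilute_linear_le_rodForm`); (d) only `o(N)` (indeed `O(N/√log N)`), not the expected `N^{1/2−ρa+…}`; (e) not Dirichlet boxes (parent (iii)); (f) independent numerical check of this audit: exact-sampling Monte Carlo of `c₀(N, η)/N` for `N ≤ 512`, `η ∈ {0, 0.1, 0.25, 0.5}` (compute job of the audit folder, `rods_mc.py`; controls `N = 2`: `c₀ = 16(1−η)/π²` exact, and `η = 0`: `1.5427√N − 0.5725` [cite: ForresterEtAl2003, §2.2.3])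
status: THEOREM of the tree as typed (`ρa < 1/2`: `OneDimensionalHardRods_holds`, 2026-08-16; `a = 0` also `oneDimensionalHardRods_zero_range`); theorem on paper in this entry for `ρa ∉ {(2j−1)/(2j)}`; folklore-level physics in print for all `ρa < 1` (Luttinger liquid, QMC) [cite: MazzantiEtAl2008, p. 4], not located in print as a theorem (searches of the fifth–eighth audits)
[cite: MazzantiEtAl2008, Eqs. (2)–(5), Eq. (11) and p. 4] [cite: Nagamiya1940] -/
def OneDimensionalHardRods : Prop :=
  ∀ a : ℝ, 0 ≤ a → ∀ ρ : ℝ, 0 < ρ → ρ * a < 1 / 2 →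
    Tendsto (fun N : ℕ => rodZeroMomentumOccupation N (N / ρ) a / N) atTop (𝓝 0)

/-- **The zero-range instance of the rod barrier is a theorem** (non-vacuity and consistency):
for `a = 0` the rod objects are Girardeau's (`rodZeroMomentumOccupation_zero_range`) and the
parent's thermodynamic-limit form `tendsto_zeroMomentumOccupation_div_anyBox` applies in the boxes
`L = N/ρ`. [cite: ForresterEtAl2003, §2.2.2] -/
theorem oneDimensionalHardRods_zero_range (ρ : ℝ) (hρ : 0 < ρ) :
    Tendsto (fun N : ℕ => rodZeroMomentumOccupation N (N / ρ) 0 / N) atTop (𝓝 0) := by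
  have hL : ∀ N : ℕ, 0 < (max (N : ℝ) 1) / ρ := fun N => by positivity
  refine (tendsto_zeroMomentumOccupation_div_anyBox (fun N : ℕ => max (N : ℝ) 1 / ρ) hL).congr' ?_
  filter_upwards [eventually_ge_atTop 1] with N hN
  have hN1 : (1 : ℝ) ≤ N := by exact_mod_cast hN
  have hNρ : 0 < (N : ℝ) / ρ := by positivity
  show zeroMomentumOccupation N (max (N : ℝ) 1 / ρ) / N = rodZeroMomentumOccupation N (N / ρ) 0 / N
  rw [max_eq_left hN1, rodZeroMomentumOccupation_zero_range N hNρ]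

/-- The rod barrier contains the parent's typed fact along the thermodynamic limit: at `a = 0`
it is `c₀(N, N/ρ)/N → 0` for Girardeau's gas. [cite: ForresterEtAl2003, §2.2.2] -/
theorem OneDimensionalHardRods.girardeau (h : OneDimensionalHardRods) (ρ : ℝ) (hρ : 0 < ρ) :
    Tendsto (fun N : ℕ => zeroMomentumOccupation N (N / ρ) / N) atTop (𝓝 0) := by
  refine (h 0 le_rfl ρ hρ (by norm_num)).congr' ?_
  filter_upwards [eventually_ge_atTop 1] with N hN
  have hNρ : 0 < (N : ℝ) / ρ := by
    have : (1 : ℝ) ≤ N := by exact_mod_cast hN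
    positivity
  show rodZeroMomentumOccupation N (N / ρ) 0 / N = zeroMomentumOccupation N (N / ρ) / N
  rw [rodZeroMomentumOccupation_zero_range N hNρ]

end Literature.Barriers.AtomisticToContinuum

end
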